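import Summits.Ventures.YMGap.RobustBall.DobrushinPairwise
import Summits.Ventures.YMGap.RobustBall.ZdPairwiseColumn
import Summits.Ventures.YMGap.RobustBall.TorusAxisColumn
import Summits.Ventures.YMGap.SlabAreaLawDimensions
import HarnessLib

/-!
# Robust ball (Y2) — TORUS CLUSTERING ON THE TIER-1 BALL AT THE AXIS RATE: `TorusClusteringOnBall N d β ε₀ ε₁ r (8N/(θ(1−s))) (2 log θ⁻¹)`

HONEST FRAMING: venture file of the cell `pub-ymgap` (QuantumFields programme), track ROBUST-BALL, seat rb-p2 (g10).  Strong-coupling LATTICE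
statement on finite tori `(ℤ/L)^d`, `L ≥ 3`, in the TREE currency `ClustersWith` / `TorusClusteringOnBall` of `RobustBall/Defs` (exponential
clustering of the member's torus measure in the `ℓ∞` torus distance of the supports, constants uniform in `L` and in the member); the one-link
modulus `OneLinkKRModulus N R K` is a hypothesis by name (cells use the tree's quarter modulus for `SU(2)`); nothing continuum / Clay.
WHAT IT DOES.  The single-link robust torus door (ds-2's `isKRContraction_perturbedTorusSpec_of_hasRange`: `C_W(x,z) = A(x) n(x,z) + √N ℓ(x,z)`,
`A(x) = K e^{a(x)}(1 + 2√N ℓ_s(x))|β|/N`, neighbourhoods of range `r ⊔ 1`) is run through Föllmer's PAIRWISE covariance estimate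
(`DobrushinPairwise.abs_covariance_le_of_pair_profile`) with, for every target link `y`, the column supersolution
`p(x,y) = min_i g(H_i x − H_i y)`, `g` the cycle eigenvector `θ^k + θ^{2L−k}` on `ℤ/2L` and `H_i` the doubled cyclic `i`-coordinate of a link
(`TorusAxisProfile.sum_tInfluence_mul_le_axis`).  The minimum over axes is again a supersolution, and for a pair `(x, y)` at torus distance `≥ n` the
axis realising the distance gives `p(x,y)/p(y,y) ≤ 2θ^{2n−1}`.  RESULT (`clustersWith_axis`, `torusClusteringOnBall_axis`): for `d ≥ 2`, `N ≥ 1`, a modulus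
on `R ≥ 2(d−1)|β|/N`, `0 < θ ≤ 1`, `s < 1` and the single row condition
`K e^{ε₀}(1 + 2√N ε₁)(|β|/N)·P(θ) + √N ε₁ θ⁻¹^{2(r ⊔ 1)+1} ≤ s`, `P(θ) = max(2(d−1)(θ+θ⁻¹+1), θ⁻²+2θ⁻¹+2θ+θ²+6(d−2))`,
EVERY member `W ∈ ClusterDomainFR ε₀ ε₁ r` on EVERY torus `L ≥ 3` satisfies `ClustersWith W β (8N/(θ(1−s))) (2 log θ⁻¹)` — rate `2 log θ⁻¹` PER UNIT OF
TORUS DISTANCE, against the star door's `κ₁/((r ⊔ 1)+2)`, `κ₁ = (1−ρ)²/(2(4dρ+1))` (`RobustStarDoor`) in the same currency on the same ball.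
`torusClusteringOnBallUpTo_axis`: the same UP TO `β⋆` (monotone row condition).  `SU(2)`, `d = 4` cell: ball `(ε₀, ε₁, r) = (1/100, 1/500, 1)` up to / at `β_W = 1/8`:
`θ = 1/3`, rate `2 log 3 = 2.20`, constant `1920` (`su2_torusClusteringOnBallUpTo_axis_oneEighth`, `su2_torusClusteringOnBall_axis_oneEighth`).

## References
* H. Föllmer, LNM 1362 (1988), Ch. I, Thm. (2.13); H. Künsch, CMP 84 (1982) 207; R. L. Dobrushin, Theory Probab. Appl. 15 (1970) 458.
* The tree: `DobrushinPairwise`, `TorusAxisProfile` (this seat), `TorusDoor` (ds-2), `RobustStarDoor` (the star-door rates this file supersedes in rate).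
-/

noncomputable section

open MeasureTheory ProbabilityTheory Finset Function Real
open Literature.Probability.LatticeModels Literature.Probability.LatticeModels.DobrushinMetric
open Literature.MathematicalPhysics.QuantumLattice hiding torusNorm
open Literature.MathematicalPhysics.QuantumFieldTheory hiding ZdEdge
open Literature.MathematicalPhysics.QuantumFieldTheory.Balaban1983to89.StrongCouplingTorusWindow
open Literature.MathematicalPhysics.QuantumFieldTheory.Balaban1983to89.StrongCouplingDobrushinWindow (OneLinkKRModulus)
open Summit.Ventures.YMGap.RobustBall.DobrushinPairwise

/-! ### The currency: `ClustersWith` at the axis rate, on the whole tier-1 ball, uniformly in `L` -/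

namespace Summit.Ventures.YMGap.RobustBall

open Summit.Ventures.YMGap.RobustBall.TorusAxis

variable {d L N : ℕ} [NeZero L]

/-- **TORUS CLUSTERING AT THE AXIS RATE FOR ONE MEMBER.**  `d ≥ 2`, `N ≥ 1`, `L ≥ 3`; a one-link modulus `OneLinkKRModulus N R K` on
`R ≥ 2(d−1)|β|/N`; `0 < θ ≤ 1`, `s < 1` with `K e^{ε₀}(1 + 2√N ε₁)(|β|/N)·max(P_∥(θ), P_⊥(θ)) + √N ε₁ θ⁻¹^{2(r⊔1)+1} ≤ s`.  Then every member
`W ∈ ClusterDomainFR ε₀ ε₁ r` satisfies `ClustersWith W β (8N/(θ(1−s))) (2 log θ⁻¹)`: for bounded measurable local Lipschitz `f, g` whose supports are at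
torus distance `≥ n`, `|cov_{β,W,L}(f,g)| ≤ (8N/(θ(1−s))) (Σδ_g)(Σδ_f) θ^{2n}`. [folklore] -/
theorem clustersWith_axis (hd : 2 ≤ d) (hN : 1 ≤ N) (hL : 3 ≤ L) {β ε₀ ε₁ R K θ s : ℝ} {r : ℕ} (hK : 0 ≤ K)
    (hR : |β| / N * (2 * ((d : ℝ) - 1)) ≤ R) (hmod : OneLinkKRModulus N R K) (hθ0 : 0 < θ) (hθ1 : θ ≤ 1) (hs1 : s < 1)
    (hsup : K * Real.exp ε₀ * (1 + 2 * Real.sqrt N * ε₁) * (|β| / N) *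
        max (2 * ((d : ℝ) - 1) * (θ + θ⁻¹ + 1)) (θ⁻¹ ^ 2 + 2 * θ⁻¹ + 2 * θ + θ ^ 2 + 6 * ((d : ℝ) - 2)) +
      Real.sqrt N * ε₁ * θ⁻¹ ^ (2 * max r 1 + 1) ≤ s)
    {W : Perturbation d L N} (hW : W ∈ ClusterDomainFR ε₀ ε₁ r) :
    ClustersWith W β (8 * N / (θ * (1 - s))) (2 * Real.log θ⁻¹) := by
  classical
  obtain ⟨hr, w, hwa, hwℓ⟩ := exists_witness_of_mem_clusterDomainFR hW
  have hL1 : 1 < L := by omega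
  have hL2 : 2 ≤ L := by omega
  have hd1 : 1 ≤ d := by omega
  haveI : NeZero (2 * L) := ⟨by omega⟩
  have hKR := isKRContraction_perturbedTorusSpec_of_hasRange (β := β) hd1 hN hL1 hK hR hmod w hr
  have hrow : ∀ x : Edge d L, ∑ z ∈ (univ.erase x).filter (fun y => torusNorm (x.1 - y.1) ≤ max r 1),
      (K * Real.exp (w.oscLoad 0 x) * (1 + 2 * Real.sqrt N * w.selfLipLoad 0 x) * (|β| / N) * tInfluence x z +
        Real.sqrt N * w.crossLip 0 x z) ≤ s := fun x => row_axis_le hd hL2 hK hθ0 hθ1 w hwa hwℓ hsup x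
  have hs0 : 0 ≤ s := le_trans (Finset.sum_nonneg fun z _ => robustEntry_nonneg hK β w _ z) (hrow ((fun _ => 0), ⟨0, by omega⟩))
  -- the profile: minimum over the axes of the cycle eigenvector in the doubled coordinates
  obtain ⟨g, hg0, hg00, hg1, hgu, hgd, hdec⟩ := exists_cycleProfile_twoSided (M := 2 * L) (by omega) hθ0 hθ1
  have huniv : (Finset.univ : Finset (Fin d)).Nonempty := ⟨⟨0, by omega⟩, Finset.mem_univ _⟩
  set Hc : Fin d → Edge d L → ZMod (2 * L) := fun i x => ((2 * (x.1 i).val : ℕ) : ZMod (2 * L)) + (if x.2 = i then 1 else 0)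
    with hHc
  set p : Edge d L → Edge d L → ℝ := fun x y => Finset.univ.inf' huniv fun i => g (Hc i x - Hc i y) with hp
  have hp0 : ∀ x y, 0 ≤ p x y := fun x y => (Finset.le_inf'_iff huniv _).2 fun i _ => (hg0 _).le
  have hpyy : ∀ y, p y y = g 0 := fun y => by
    refine le_antisymm ((Finset.inf'_le _ (Finset.mem_univ (⟨0, by omega⟩ : Fin d))).trans (by rw [sub_self])) ?_
    exact (Finset.le_inf'_iff huniv _).2 fun i _ => by rw [sub_self]
  have hpy : ∀ y, 0 < p y y := fun y => by rw [hpyy]; exact hg0 0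
  have hcol : ∀ (y x : Edge d L), ∑ z ∈ (univ.erase x).filter (fun y => torusNorm (x.1 - y.1) ≤ max r 1),
      (K * Real.exp (w.oscLoad 0 x) * (1 + 2 * Real.sqrt N * w.selfLipLoad 0 x) * (|β| / N) * tInfluence x z +
        Real.sqrt N * w.crossLip 0 x z) * p z y ≤ s * p x y := by
    intro y x
    obtain ⟨i₀, -, hi₀⟩ := Finset.exists_mem_eq_inf' huniv (fun i => g (Hc i x - Hc i y))
    have hpx : p x y = g (Hc i₀ x - Hc i₀ y) := hi₀
    calc ∑ z ∈ (univ.erase x).filter (fun y => torusNorm (x.1 - y.1) ≤ max r 1),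
          (K * Real.exp (w.oscLoad 0 x) * (1 + 2 * Real.sqrt N * w.selfLipLoad 0 x) * (|β| / N) * tInfluence x z +
            Real.sqrt N * w.crossLip 0 x z) * p z y
        ≤ ∑ z ∈ (univ.erase x).filter (fun y => torusNorm (x.1 - y.1) ≤ max r 1),
          (K * Real.exp (w.oscLoad 0 x) * (1 + 2 * Real.sqrt N * w.selfLipLoad 0 x) * (|β| / N) * tInfluence x z +
            Real.sqrt N * w.crossLip 0 x z) * g (Hc i₀ z - Hc i₀ y) :=
          Finset.sum_le_sum fun z _ => mul_le_mul_of_nonneg_left (Finset.inf'_le _ (Finset.mem_univ i₀))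
            (robustEntry_nonneg hK β w x z)
      _ ≤ s * g (Hc i₀ x - Hc i₀ y) := column_axis_le hd hL2 hK hθ0 hθ1 w hwa hwℓ hsup hg0 hg1 hgu hgd x i₀ (Hc i₀ y)
      _ = s * p x y := by rw [hpx]
  -- the pair profile bound from the torus distance
  have hpt : ∀ (x y : Edge d L) (n : ℕ), n ≤ torusNorm (x.1 - y.1) → p x y / p y y ≤ 2 * θ⁻¹ * (θ ^ 2) ^ n := by
    intro x y n hn
    rw [hpyy]
    refine (div_le_self (hp0 x y) hg00).trans ?_
    obtain ⟨i, -, hi⟩ := Finset.exists_mem_eq_sup (Finset.univ : Finset (Fin d)) huniv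
      (fun j => (((x.1 - y.1) j).valMinAbs).natAbs)
    have hni : n ≤ ((x.1 i - y.1 i).valMinAbs).natAbs := by
      have h' : torusNorm (x.1 - y.1) = (((x.1 - y.1) i).valMinAbs).natAbs := hi
      rw [h', Pi.sub_apply] at hn; exact hn
    refine (Finset.inf'_le _ (Finset.mem_univ i)).trans ?_
    obtain ⟨h1, h2⟩ := le_abs_val_sub_of_le_valMinAbs hni
    set δ : ℤ := ((x.1 i).val : ℤ) - (y.1 i).val with hδ
    set ex : ℤ := if x.2 = i then 1 else 0 with hex
    set ey : ℤ := if y.2 = i then 1 else 0 with hey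
    have hex' : ex = 0 ∨ ex = 1 := by by_cases h : x.2 = i <;> simp [hex, h]
    have hey' : ey = 0 ∨ ey = 1 := by by_cases h : y.2 = i <;> simp [hey, h]
    have hva : ((x.1 i).val : ℤ) < L := by exact_mod_cast ZMod.val_lt (x.1 i)
    have hvb : ((y.1 i).val : ℤ) < L := by exact_mod_cast ZMod.val_lt (y.1 i)
    have ha0 : (0 : ℤ) ≤ (x.1 i).val := by positivity
    have hb0 : (0 : ℤ) ≤ (y.1 i).val := by positivity
    have h1' := le_abs'.1 h1
    have h2' := abs_le.1 (show |δ| ≤ (L : ℤ) - n by linarith)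
    set Kz : ℤ := 2 * δ + (ex - ey) with hKz
    have hHK : Hc i x - Hc i y = ((Kz : ℤ) : ZMod (2 * L)) := by
      simp only [hHc, hKz, hδ, hex, hey]; exact hc_sub_eq_intCast x y i
    have hj : (((2 * n - 1 : ℕ) : ℤ)) ≤ |Kz| := by
      have : ((2 * n - 1 : ℕ) : ℤ) ≤ Kz ∨ ((2 * n - 1 : ℕ) : ℤ) ≤ -Kz := by omega
      rcases this with h | h
      · exact h.trans (le_abs_self Kz)
      · exact h.trans (neg_le_abs Kz)
    have hjK : ((2 * n - 1 : ℕ) : ℤ) + |Kz| ≤ ((2 * L : ℕ) : ℤ) := by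
      have : |Kz| ≤ ((2 * L : ℕ) : ℤ) - ((2 * n - 1 : ℕ) : ℤ) := abs_le.2 ⟨by push_cast; omega, by push_cast; omega⟩
      linarith
    rw [hHK]
    refine (profile_intCast_le (M := 2 * L) hdec hj hjK).trans ?_
    rw [mul_assoc]
    exact mul_le_mul_of_nonneg_left (ZdAxis.pow_two_mul_sub_one_le' hθ0 hθ1 n) zero_le_two
  -- Föllmer's pairwise estimate
  intro f g' Δf Δg δf δg n hfm hgm hfdep hgdep hfb hgb hδf hδg hdist
  obtain ⟨Mf, hMf⟩ := hfb
  obtain ⟨Mg, hMg⟩ := hgb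
  have key := abs_covariance_le_of_pair_profile (isSpecification_perturbedTorusSpec W β) hKR (r := suFrobDist)
    (R := 2 * Real.sqrt N) suFrobDist_nonneg suFrobDist_le (by positivity) hs0 hs1 hrow (isGibbsMeasure_perturbedMeasure W β)
    hfm hfdep hMf hδf hgm hgdep hMg hδg hs1 hp0 (fun y _ => hpy y) (fun y _ x => hcol y x) (B := 2 * θ⁻¹) (t := (θ ^ 2) ^ n)
    (fun x hx y hy => hpt x y n (hdist x hx y hy))
  refine key.trans (le_of_eq ?_)
  have hN4 : (2 * Real.sqrt (N : ℝ)) ^ 2 = 4 * N := by rw [mul_pow, Real.sq_sqrt (by positivity)]; norm_num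
  have hexp : Real.exp (-(2 * Real.log θ⁻¹) * n) = (θ ^ 2) ^ n := by
    rw [Real.log_inv, show -(2 * -Real.log θ) * (n : ℝ) = (n : ℝ) * Real.log (θ ^ 2) by rw [Real.log_pow]; push_cast; ring,
      Real.exp_nat_mul, Real.exp_log (by positivity)]
  rw [hN4, hexp]
  have h1s : (1 - s) ≠ 0 := by linarith
  field_simp
  ring

/-- **TORUS CLUSTERING ON THE WHOLE TIER-1 BALL AT THE AXIS RATE, uniformly in `L ≥ 3`:** `TorusClusteringOnBall N d β ε₀ ε₁ r (8N/(θ(1−s))) (2 log θ⁻¹)`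
under the hypotheses of `clustersWith_axis`. [folklore] -/
theorem torusClusteringOnBall_axis (hd : 2 ≤ d) (hN : 1 ≤ N) {β ε₀ ε₁ R K θ s : ℝ} {r : ℕ} (hK : 0 ≤ K)
    (hR : |β| / N * (2 * ((d : ℝ) - 1)) ≤ R) (hmod : OneLinkKRModulus N R K) (hθ0 : 0 < θ) (hθ1 : θ ≤ 1) (hs1 : s < 1)
    (hsup : K * Real.exp ε₀ * (1 + 2 * Real.sqrt N * ε₁) * (|β| / N) *
        max (2 * ((d : ℝ) - 1) * (θ + θ⁻¹ + 1)) (θ⁻¹ ^ 2 + 2 * θ⁻¹ + 2 * θ + θ ^ 2 + 6 * ((d : ℝ) - 2)) +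
      Real.sqrt N * ε₁ * θ⁻¹ ^ (2 * max r 1 + 1) ≤ s) :
    TorusClusteringOnBall N d β ε₀ ε₁ r (8 * N / (θ * (1 - s))) (2 * Real.log θ⁻¹) :=
  fun _L _ hL _W hW => clustersWith_axis hd hN hL hK hR hmod hθ0 hθ1 hs1 hsup hW

/-- **… UP TO `β⋆`** (ym3ir-theory-1's receiving currency `TorusClusteringOnBallUpTo`): the row condition is monotone in `|β|`, so the condition at `β⋆ ≥ 0`
gives `TorusClusteringOnBallUpTo N d β⋆ ε₀ ε₁ r (8N/(θ(1−s))) (2 log θ⁻¹)` — every tree coupling `0 ≤ β ≤ β⋆`, one constant, one rate (`ε₁ ≥ 0`). [folklore] -/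
theorem torusClusteringOnBallUpTo_axis (hd : 2 ≤ d) (hN : 1 ≤ N) {βs ε₀ ε₁ R K θ s : ℝ} {r : ℕ} (hK : 0 ≤ K) (hε₁ : 0 ≤ ε₁)
    (hR : βs / N * (2 * ((d : ℝ) - 1)) ≤ R) (hmod : OneLinkKRModulus N R K) (hθ0 : 0 < θ) (hθ1 : θ ≤ 1) (hs1 : s < 1)
    (hsup : K * Real.exp ε₀ * (1 + 2 * Real.sqrt N * ε₁) * (βs / N) *
        max (2 * ((d : ℝ) - 1) * (θ + θ⁻¹ + 1)) (θ⁻¹ ^ 2 + 2 * θ⁻¹ + 2 * θ + θ ^ 2 + 6 * ((d : ℝ) - 2)) +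
      Real.sqrt N * ε₁ * θ⁻¹ ^ (2 * max r 1 + 1) ≤ s) :
    TorusClusteringOnBallUpTo N d βs ε₀ ε₁ r (8 * N / (θ * (1 - s))) (2 * Real.log θ⁻¹) := by
  intro β hβ0 hβ
  have hab : |β| = β := abs_of_nonneg hβ0
  have hd2 : (2 : ℝ) ≤ d := by exact_mod_cast hd
  have hd1 : 0 ≤ 2 * ((d : ℝ) - 1) := by linarith
  have hN0 : (0 : ℝ) < N := by exact_mod_cast hN
  have hdiv : |β| / N ≤ βs / N := by rw [hab]; exact div_le_div_of_nonneg_right hβ hN0.le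
  have hP0 : 0 ≤ max (2 * ((d : ℝ) - 1) * (θ + θ⁻¹ + 1)) (θ⁻¹ ^ 2 + 2 * θ⁻¹ + 2 * θ + θ ^ 2 + 6 * ((d : ℝ) - 2)) :=
    le_max_of_le_left (mul_nonneg hd1 (by positivity))
  have hc0 : 0 ≤ K * Real.exp ε₀ * (1 + 2 * Real.sqrt N * ε₁) := by positivity
  refine torusClusteringOnBall_axis hd hN hK ((mul_le_mul_of_nonneg_right hdiv hd1).trans hR) hmod hθ0 hθ1 hs1 (le_trans ?_ hsup)
  have h1 : K * Real.exp ε₀ * (1 + 2 * Real.sqrt N * ε₁) * (|β| / N) ≤ K * Real.exp ε₀ * (1 + 2 * Real.sqrt N * ε₁) * (βs / N) :=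
    mul_le_mul_of_nonneg_left hdiv hc0
  exact add_le_add (mul_le_mul_of_nonneg_right h1 hP0) le_rfl

/-- ★ **`SU(2)`, `d = 4`, the BALL `(ε₀, ε₁, r) = (1/100, 1/500, 1)` UP TO `β_W = 1/8`** (tree couplings `0 ≤ β ≤ 1/16`; quarter modulus `K = 1` on radius `3/16`):
`θ = 1/3`, `s = 39/40`, i.e. `TorusClusteringOnBallUpTo 2 4 (1/16) (1/100) (1/500) 1 1920 (2 log 3)` — rate `2 log 3 = 2.197` per unit of torus distance for every
member on every torus `L ≥ 3` at every coupling up to `β_W = 1/8` (the star door's rate on this ball is `< 10⁻²`).  Check at `β_W = 1/8`: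
`e^{1/100}(1 + 2√2/500)(1/32)(250/9) + √2·27/500 ≤ 1.02·1.006·0.8681 + 0.081 = 0.972 ≤ 0.975`. [folklore] -/
theorem su2_torusClusteringOnBallUpTo_axis_oneEighth :
    TorusClusteringOnBallUpTo 2 4 (1 / 16) (1 / 100) (1 / 500) 1 1920 (2 * Real.log 3) := by
  have hmod := SlabAreaLawDimensions.su2_oneLinkKRModulus_of_le_one (R := 3 / 16) (by norm_num)
  have hexp : Real.exp (1 / 100 : ℝ) ≤ 51 / 50 := by
    have h := Real.exp_bound_div_one_sub_of_interval' (x := 1 / 100) (by norm_num) (by norm_num)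
    have : (1 : ℝ) / (1 - 1 / 100) ≤ 51 / 50 := by norm_num
    linarith
  have hsqrt : Real.sqrt 2 ≤ 3 / 2 := by
    rw [show (3 / 2 : ℝ) = Real.sqrt ((3 / 2) ^ 2) by rw [Real.sqrt_sq (by norm_num)]]
    exact Real.sqrt_le_sqrt (by norm_num)
  have hsqrt0 : 0 ≤ Real.sqrt 2 := Real.sqrt_nonneg _
  have h := torusClusteringOnBallUpTo_axis (d := 4) (N := 2) (by norm_num) (by norm_num) (βs := 1 / 16) (ε₀ := 1 / 100) (ε₁ := 1 / 500)
    (θ := 1 / 3) (s := 39 / 40) (r := 1) zero_le_one (by norm_num) (by norm_num) hmod (by norm_num) (by norm_num) (by norm_num) ?_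
  · have e1 : (8 * (2 : ℕ) / ((1 / 3 : ℝ) * (1 - 39 / 40))) = 1920 := by norm_num
    have e2 : (2 * Real.log (1 / 3 : ℝ)⁻¹) = 2 * Real.log 3 := by norm_num
    rw [e1, e2] at h
    exact h
  · have hmax : max (2 * ((4 : ℕ) - 1 : ℝ) * ((1 / 3 : ℝ) + (1 / 3)⁻¹ + 1))
        ((1 / 3 : ℝ)⁻¹ ^ 2 + 2 * (1 / 3 : ℝ)⁻¹ + 2 * (1 / 3) + (1 / 3) ^ 2 + 6 * ((4 : ℕ) - 2 : ℝ)) = 250 / 9 := by norm_num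
    have hm1 : (2 * max 1 1 + 1 : ℕ) = 3 := by norm_num
    rw [hmax, hm1]
    have h3 : Real.exp (1 / 100) * (1 + 2 * Real.sqrt (2 : ℕ) * (1 / 500)) ≤ 51 / 50 * (1 + 2 * (3 / 2) * (1 / 500)) := by
      have : Real.sqrt (2 : ℕ) = Real.sqrt 2 := by norm_num
      rw [this]
      exact mul_le_mul hexp (by linarith) (by positivity) (by norm_num)
    have hcast : Real.sqrt ((2 : ℕ) : ℝ) = Real.sqrt 2 := by norm_num
    have h4 : Real.sqrt ((2 : ℕ) : ℝ) ≤ 3 / 2 := by rw [hcast]; exact hsqrt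
    have h5 : 0 ≤ Real.sqrt (2 : ℕ) := Real.sqrt_nonneg _
    nlinarith [h3, h4, h5, Real.exp_pos (1 / 100 : ℝ)]

/-- ★ **`SU(2)`, `d = 4`, the BALL `(ε₀, ε₁, r) = (1/100, 1/500, 1)` at `β_W = 1/8`** (tree coupling `1/16`, 't Hooft `1/32`; quarter modulus `K = 1` on
radius `3/16`): `θ = 1/3`, `s = 39/40`, i.e. `TorusClusteringOnBall 2 4 (1/16) (1/100) (1/500) 1 1920 (2 log 3)` — rate `2 log 3 = 2.197` per unit of torus
distance for every member on every torus `L ≥ 3` (the star door's rate on this ball is `< 10⁻²`). [folklore] -/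
theorem su2_torusClusteringOnBall_axis_oneEighth :
    TorusClusteringOnBall 2 4 (1 / 16) (1 / 100) (1 / 500) 1 1920 (2 * Real.log 3) :=
  su2_torusClusteringOnBallUpTo_axis_oneEighth (1 / 16) (by norm_num) le_rfl

end Summit.Ventures.YMGap.RobustBall

end
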